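import Summits.QuantumFields.QCD.Theorems.QuarksAsStableActionStableActionBridgeStubFockLiftComplement
import Summits.QuantumFields.QCD.Theorems.QuarksAsStableActionStableActionBridgeStubFermionSliceMatrixChargeConj
import Summits.QuantumFields.QCD.Theorems.QuarksAsStableActionStableActionBridgeFermionSlicePosDef
import Summits.QuantumFields.QCD.Theorems.QuarksAsStableActionStableActionBridgeFermionSliceOpCovariance
import HarnessLib

/-!
# Charge conjugation of the fermionic transfer operator `T̂_F(U) = det(A)² Γ(M_F(U))`
(stub `stub_fermionSliceOp_chargeConj` of line `twisted_trace_transfer` for crux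
`QuarksAsStableAction.StableActionBridge`, item stmt-QuantumFields-9737, `--supports`)

To see that the vacuum of Lüscher's transfer matrix of lattice QCD is fermion-even, the line uses charge
conjugation: the particle–hole map `P_h = particleHole 1` on the slice Fock space together with complex
conjugation `U ↦ Ū` (`suConj 3`) of the spatial links.  This file proves the conjugation law of Smit's
fermionic transfer operator `T̂_F(U) = det(A)² · Γ(M̃(U))`, `M̃ := reindex (fermionSliceMatrix U m)`
(*Introduction to Quantum Fields on a Lattice*, §6.5 (6.91)):

  `P_h T̂_F(U) P_hᴴ = Γ(W̃) T̂_F(Ū) Γ(W̃)ᴴ`,  `W̃ = reindex (1 ⊗ C γ₄)`, `C = chargeConj`.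

Proof.
1. `P_h Γ(M̃) P_hᴴ = det M̃ · Γ(M̃⁻ᵀ)` (landed `StubFockLiftComplement.particleHole_one_conj_Gamma`,
   `fockLift = Gamma`).
2. **`det M_F = 1`**: the landed spin rotation `V = 1 ⊗ γ₄γ₅` conjugates `M_F` into
   `(1 + Nᴴ)(A ⊗ P⁺ + A⁻¹ ⊗ P⁻)(1 + N)` (`fermionSliceMatrix_conj_gamma05`), which is `M_F⁻¹`
   (`StubFermionSliceMatrixChargeConj.fermionSliceMatrix_inv`); taking determinants (`det V · det V⁻¹ = 1`)
   gives `det M_F · det M_F = 1`, and `det M_F > 0` because `M_F` is positive definite for `m_f > −1`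
   (`fermionSliceMatrix_posDef`), so `det M_F = 1` (the root `−1` of `d² = 1` is not positive).
3. `M̃⁻ᵀ = reindex (M_F⁻ᵀ) = reindex (W M_F(Ū) Wᴴ)` (`fermionSliceMatrix_inv_transpose`), and `Γ` is
   multiplicative and `ᴴ`-compatible, so `Γ(M̃⁻ᵀ) = Γ(W̃) Γ(M̃(Ū)) Γ(W̃)ᴴ`.
4. `det A(Ū) = det A(U)ᵀ = det A(U)` (`sliceMassHop_suConj`), so the scalar prefactors agree.

Pure theorem file (no definitions); helpers in the sub-namespace `StubFermionSliceOpChargeConj`.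
[cite: Smit2023, §6.5 (6.91)] [cite: LuciniEtAl2016, §2 and App. D]
-/

noncomputable section

open scoped Matrix BigOperators ComplexConjugate ComplexOrder
open Literature.MathematicalPhysics.QuantumFieldTheory Literature.MathematicalPhysics.QuantumLattice

namespace Summit.QuantumFields.QCD.Cruxes.StableActionBridge.TwistedTraceTransfer

namespace StubFermionSliceOpChargeConj

open Matrix
open Summit.QuantumFields.QCD.Cruxes.StableActionBridge.Sketch

variable {Nf S : ℕ} [NeZero S]

/-- A positive complex number `d` with `d = d⁻¹` is `1`. [folklore] -/
theorem eq_one_of_pos_of_eq_inv {d : ℂ} (hpos : 0 < d) (h : d = d⁻¹) : d = 1 := by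
  have hd : d ≠ 0 := hpos.ne'
  have hsq : d * d = 1 := by
    nth_rewrite 2 [h]
    exact mul_inv_cancel₀ hd
  rcases mul_self_eq_one_iff.mp hsq with h1 | h1
  · exact h1
  · exfalso
    rw [h1, Complex.lt_def] at hpos
    norm_num at hpos

/-- **`det M_F(U) = 1`** for all bare masses `m_f > −1`: `M_F` is conjugate (by `1 ⊗ γ₄γ₅`) to its own
inverse, so `det M_F = (det M_F)⁻¹`, and `det M_F > 0` by positivity. [cite: Smit2023, §6.5 (6.91)] -/
theorem det_fermionSliceMatrix_eq_one (U : GaugeConfig 3 S (Matrix.specialUnitaryGroup (Fin 3) ℂ))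
    (mq : Fin Nf → ℝ) (hm : ∀ f, -1 < mq f) : (fermionSliceMatrix U mq).det = 1 := by
  have hA : IsUnit (sliceMassHop U mq).det :=
    isUnit_iff_ne_zero.mpr (FermionSliceContinuous.sliceMassHop_det_ne_zero U mq hm)
  have hM : IsUnit (fermionSliceMatrix U mq).det :=
    (Matrix.isUnit_iff_isUnit_det _).mp (fermionSliceMatrix_posDef Nf S U mq hm).isUnit
  have hconj := fermionSliceMatrix_conj_gamma05 Nf S U mq
  rw [← StubFermionSliceMatrixChargeConj.fermionSliceMatrix_inv U mq hA] at hconj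
  have hdet := congrArg Matrix.det hconj
  rw [Matrix.det_mul, Matrix.det_mul, mul_right_comm, ← Matrix.det_mul,
    SliceGammaConjugation.gamma05_sliceKron_mul_gamma50_sliceKron, Matrix.det_one, one_mul] at hdet
  -- `hdet : det M_F = det M_F⁻¹`; and `det M_F⁻¹ * det M_F = 1`
  have hinv : (fermionSliceMatrix U mq)⁻¹.det = ((fermionSliceMatrix U mq).det)⁻¹ :=
    eq_inv_of_mul_eq_one_left (Matrix.det_nonsing_inv_mul_det _ hM)
  exact eq_one_of_pos_of_eq_inv (fermionSliceMatrix_posDef Nf S U mq hm).det_pos (hdet.trans hinv)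

end StubFermionSliceOpChargeConj

/-- **Stub `stub_fermionSliceOp_chargeConj` of line `twisted_trace_transfer`: charge conjugation of the
fermionic transfer operator.**  For all bare masses `m_f > −1` and every spatial link configuration `U`
with entrywise conjugate `Ū` (`suConj 3`), the particle–hole map `P_h = particleHole 1` of the slice Fock
space conjugates Smit's `T̂_F(U) = det(A)² Γ(M̃(U))` into `Γ(W̃) T̂_F(Ū) Γ(W̃)ᴴ`, `W̃ = reindex (1 ⊗ C γ₄)`:
`P_h Γ(M̃) P_hᴴ = det M̃ · Γ(M̃⁻ᵀ)` with `det M_F = 1`, `M_F⁻ᵀ = W M_F(Ū) Wᴴ`, `det A(Ū) = det A`.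
[cite: Smit2023, §6.5 (6.91)] [cite: LuciniEtAl2016, §2 and App. D] -/
theorem stub_fermionSliceOp_chargeConj : ∀ (Nf S : ℕ) [NeZero S] (mq : Fin Nf → ℝ), (∀ f, -1 < mq f) →
    ∀ U : GaugeConfig 3 S (Matrix.specialUnitaryGroup (Fin 3) ℂ),
    particleHole (fun _ : SliceFermiIdx Nf S => (1 : ℂ)) * fermionSliceOp U mq * (particleHole (fun _ : SliceFermiIdx Nf S => (1 : ℂ)))ᴴ =
      fockLift (Matrix.reindex sliceQuarkEquiv sliceQuarkEquiv
        (sliceKron (1 : Matrix (SliceColourVar Nf S) (SliceColourVar Nf S) ℂ) (chargeConj * euclideanGamma 0))) *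
        fermionSliceOp (fun e => suConj 3 (U e)) mq *
        (fockLift (Matrix.reindex sliceQuarkEquiv sliceQuarkEquiv
        (sliceKron (1 : Matrix (SliceColourVar Nf S) (SliceColourVar Nf S) ℂ) (chargeConj * euclideanGamma 0))))ᴴ := by
  intro Nf S _ mq hm U
  have hA : IsUnit (sliceMassHop U mq).det :=
    isUnit_iff_ne_zero.mpr (Sketch.FermionSliceContinuous.sliceMassHop_det_ne_zero U mq hm)
  have h1 : (fermionSliceMatrix U mq).det = 1 :=
    StubFermionSliceOpChargeConj.det_fermionSliceMatrix_eq_one U mq hm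
  have hMt : IsUnit (Matrix.reindex sliceQuarkEquiv sliceQuarkEquiv (fermionSliceMatrix U mq)).det := by
    rw [Matrix.det_reindex_self, h1]
    exact isUnit_one
  simp only [fermionSliceOp, Sketch.FockLiftPosDef.fockLift_eq_Gamma', Matrix.mul_smul, Matrix.smul_mul]
  rw [StubFermionSliceMatrixChargeConj.sliceMassHop_suConj, Matrix.det_transpose,
    StubFockLiftComplement.particleHole_one_conj_Gamma hMt, Matrix.det_reindex_self, h1, one_smul,
    Matrix.inv_reindex, Matrix.transpose_reindex,
    StubFermionSliceMatrixChargeConj.fermionSliceMatrix_inv_transpose U mq hA,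
    Sketch.FermionSliceOpCovariance.reindex_mul_reindex,
    Sketch.FermionSliceOpCovariance.reindex_mul_reindex, ← Matrix.conjTranspose_reindex, Gamma_mul,
    Gamma_mul, Gamma_conjTranspose]

end Summit.QuantumFields.QCD.Cruxes.StableActionBridge.TwistedTraceTransfer

end
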